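import Summits.RiemannHypothesis.RiemannHypothesis.Theorems.PfPersistenceFfWeilCriterionSharp
import Summits.RiemannHypothesis.RiemannHypothesis.Theorems.PfPersistenceFfWeilCriterionFE
import Summits.RiemannHypothesis.RiemannHypothesis.Theorems.PfPersistenceFfDialLine

/-!
# Function-field mirror: sharpness of the positivity depth at the FIXED `q = 4` — the family `H_d` and its power sums
(pub-rhpf, seat ffmirror-2 gen 7; HONEST FRAMING: mechanism/rigidity campaign — no RH claims)

`PfPersistenceFfWeilCriterionSharpAll` proved the positivity depth `2g - 1` of the finite Weil criterion sharp for
every `g`, with `q = (6g - 2)²` growing with `g`.  This file and its sequel `PfPersistenceFfWeilCriterionSharpQ4`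
answer the BOUNDED-`q` rider of door D-D (ADJ-LOG A290 (A3)): ONE prime power, `q = 4`, carries a MONIC, FE-honest,
RH-false sharpness witness of degree `2g` for every `g ≥ 6` (`g ≤ 5`: explicit small certificates, separately).
THE FAMILY (`d ≥ 2`, `g = d + 1`): `H_d = x^{2d+2} - 2x^{2d+1} - x^{d+2} - 4x^d - 2^{2d+1}x + 2^{2d+2}
= x^{d+2}·B(x) + 4·B*(x)`, the mirror at `q = 4` of `B = x^d - 2x^{d-1} - 1` (`B*(x) = x^d B(4/x)`); it is monic,
FE-honest (`hQ4_fe`), `α ↦ 4/α` permutes its roots, and in the window range `1 ≤ k ≤ 2d` exactly three elementary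
symmetric functions of the roots are nonzero: `e_1 = 2`, `e_d = (-1)^{d+1}`, `e_{d+2} = -4(-1)^d` (`esymm_hQ4`).
PROVED HERE, symbolically in `d` (no root is computed): Newton's identities (`newton_range`) collapse to the
recursion `s_n = 2s_{n-1} + [n>d] s_{n-d} + 4[n>d+2] s_{n-d-2} + (-1)^{n+1} n e_n` (`sQ4_newton`), whence the CLOSED
FORM `powerSum (frobRoots H_d) n = sQ4 d n` (`1 ≤ n ≤ 2d`, `d ≥ 3`): `2^n (n<d)`, `2^n + n2^{n-d} (n = d, d+1)`,
`2^n + 2n2^{n-d} (d+2 ≤ n < 2d)`, `4^d + 4d2^d + d (n = 2d)`.  The sequel proves `T_{2d}(4, H_d) ⪰ 0` (`d ≥ 5`)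
and a real root in `(2, 4)`.  'RH' always means the function-field `∀ α ∈ frobRoots h, ‖α‖ = √q`; nothing about `ζ`.
-/

set_option linter.dupNamespace false  -- the mandated namespace repeats `RiemannHypothesis`

noncomputable section

open Polynomial Finset
open scoped ComplexOrder

namespace Summit.RiemannHypothesis.RiemannHypothesis.Theorems.PfPersistence.FfAngleTwin

/-! ## Newton's identities in the form used here (power sums from the coefficients; no root is computed) -/

/-- Newton, `range` form: `k·e_k(A) = (-1)^{k+1} Σ_{i<k} (-1)^i e_i(A) s_{k-i}(A)`. [folklore] -/
theorem newton_range (A : Multiset ℂ) (k : ℕ) :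
    (k : ℂ) * A.esymm k =
      (-1) ^ (k + 1) * ∑ i ∈ range k, (-1) ^ i * A.esymm i * powerSum A (k - i) := by
  rw [Literature.Analysis.Complex.SCV.natCast_mul_esymm_eq_sum, sum_filter,
    Nat.sum_antidiagonal_eq_sum_range_succ_mk, sum_range_succ]
  simp only [lt_irrefl, if_false, add_zero]
  refine congrArg _ (sum_congr rfl fun i hi => ?_)
  rw [if_pos (mem_range.1 hi)]
  rfl

/-- Vieta for an integer MONIC polynomial, read on its complex root multiset:
`e_k(roots h) = (-1)^k · (coefficient of x^{deg h - k})` for `k ≤ deg h`. [folklore] -/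
theorem esymm_frobRoots {h : ℤ[X]} (hm : h.Monic) {k : ℕ} (hk : k ≤ h.natDegree) :
    (frobRoots h).esymm k = (-1) ^ k * ((h.coeff (h.natDegree - k) : ℤ) : ℂ) := by
  have hd : (h.map (Int.castRingHom ℂ)).natDegree = h.natDegree := hm.natDegree_map _
  unfold frobRoots
  rw [esymm_roots_eq_coeff (hm.map _) (by rw [hd]; exact hk), hd, coeff_map, eq_intCast]

/-- A sum over `range n` of a function supported on `{0, 1, d, d + 2}` (`2 ≤ d`). [folklore] -/
theorem sum_range_of_support_four {f : ℕ → ℂ} {d : ℕ} (hd : 2 ≤ d) (n : ℕ)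
    (hf : ∀ i, i < n → i ≠ 0 → i ≠ 1 → i ≠ d → i ≠ d + 2 → f i = 0) :
    ∑ i ∈ range n, f i =
      (if 0 < n then f 0 else 0) + (if 1 < n then f 1 else 0) + (if d < n then f d else 0) +
        (if d + 2 < n then f (d + 2) else 0) := by
  have key : ∀ i, i < n → f i = (if i = 0 then f 0 else 0) + (if i = 1 then f 1 else 0) +
      (if i = d then f d else 0) + (if i = d + 2 then f (d + 2) else 0) := by
    intro i hi
    by_cases h0 : i = 0
    · subst h0; rw [if_pos rfl, if_neg (by omega), if_neg (by omega), if_neg (by omega)]; ring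
    by_cases h1 : i = 1
    · subst h1; rw [if_neg (by omega), if_pos rfl, if_neg (by omega), if_neg (by omega)]; ring
    by_cases h2 : i = d
    · subst h2; rw [if_neg h0, if_neg h1, if_pos rfl, if_neg (by omega)]; ring
    by_cases h3 : i = d + 2
    · subst h3; rw [if_neg h0, if_neg h1, if_neg h2, if_pos rfl]; ring
    rw [if_neg h0, if_neg h1, if_neg h2, if_neg h3, hf i hi h0 h1 h2 h3]; ring
  rw [sum_congr rfl fun i hi => key i (mem_range.1 hi)]
  simp only [sum_add_distrib, sum_ite_eq', mem_range]

/-! ## The family `H_d` (`g = d + 1`, `q = 4`) -/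

/-- The diagonal mirror polynomial at `q = 4`, `g = d + 1`:
`H_d = x^{2d+2} - 2x^{2d+1} - x^{d+2} - 4x^d - 2^{2d+1}x + 2^{2d+2}`
(`= x^{d+2}·B(x) + 4·x^d·B(4/x)` with `B = x^{d-1}(x - 2) - 1`). [folklore] -/
def hQ4 (d : ℕ) : ℤ[X] :=
  X ^ (2 * d + 2) - C 2 * X ^ (2 * d + 1) - X ^ (d + 2) - C 4 * X ^ d - C (2 ^ (2 * d + 1)) * X
    + C (2 ^ (2 * d + 2))

/-- The coefficients of `H_d`. [folklore] -/
theorem coeff_hQ4 (d j : ℕ) : (hQ4 d).coeff j =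
    (if j = 2 * d + 2 then 1 else 0) - (if j = 2 * d + 1 then 2 else 0) - (if j = d + 2 then 1 else 0)
      - (if j = d then 4 else 0) - (if j = 1 then 2 ^ (2 * d + 1) else 0)
      + (if j = 0 then 2 ^ (2 * d + 2) else 0) := by
  simp only [hQ4, coeff_add, coeff_sub, coeff_X_pow, coeff_C_mul, coeff_X, coeff_C, mul_ite, mul_one,
    mul_zero]
  congr 2
  first | rfl | (split_ifs <;> first | rfl | omega)

/-- `H_d` is monic. [folklore] -/
theorem hQ4_monic (d : ℕ) (hd : 2 ≤ d) : (hQ4 d).Monic := by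
  unfold hQ4
  monicity <;> omega

/-- `deg H_d = 2d + 2 = 2g`. [folklore] -/
theorem natDegree_hQ4 (d : ℕ) (hd : 2 ≤ d) : (hQ4 d).natDegree = 2 * d + 2 := by
  unfold hQ4; compute_degree <;> omega

/-! ## Coefficient table, functional equation, elementary symmetric functions -/

/-- Leading coefficient. [folklore] -/
theorem coeff_hQ4_top (d : ℕ) (hd : 2 ≤ d) : (hQ4 d).coeff (2 * d + 2) = 1 := by
  rw [coeff_hQ4, if_pos rfl, if_neg (show 2 * d + 2 ≠ 2 * d + 1 by omega),
    if_neg (show 2 * d + 2 ≠ d + 2 by omega), if_neg (show 2 * d + 2 ≠ d by omega),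
    if_neg (show 2 * d + 2 ≠ 1 by omega), if_neg (show 2 * d + 2 ≠ 0 by omega)]
  ring

/-- Coefficient of `x^{2d+1}`. [folklore] -/
theorem coeff_hQ4_sub_one (d : ℕ) (hd : 2 ≤ d) : (hQ4 d).coeff (2 * d + 1) = -2 := by
  rw [coeff_hQ4, if_neg (show 2 * d + 1 ≠ 2 * d + 2 by omega), if_pos rfl,
    if_neg (show 2 * d + 1 ≠ d + 2 by omega), if_neg (show 2 * d + 1 ≠ d by omega),
    if_neg (show 2 * d + 1 ≠ 1 by omega), if_neg (show 2 * d + 1 ≠ 0 by omega)]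
  ring

/-- Coefficient of `x^{d+2}`. [folklore] -/
theorem coeff_hQ4_mid_hi (d : ℕ) (hd : 2 ≤ d) : (hQ4 d).coeff (d + 2) = -1 := by
  rw [coeff_hQ4, if_neg (show d + 2 ≠ 2 * d + 2 by omega), if_neg (show d + 2 ≠ 2 * d + 1 by omega),
    if_pos rfl, if_neg (show d + 2 ≠ d by omega), if_neg (show d + 2 ≠ 1 by omega),
    if_neg (show d + 2 ≠ 0 by omega)]
  ring

/-- Coefficient of `x^d`. [folklore] -/
theorem coeff_hQ4_mid_lo (d : ℕ) (hd : 2 ≤ d) : (hQ4 d).coeff d = -4 := by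
  rw [coeff_hQ4, if_neg (show d ≠ 2 * d + 2 by omega), if_neg (show d ≠ 2 * d + 1 by omega),
    if_neg (show d ≠ d + 2 by omega), if_pos rfl, if_neg (show d ≠ 1 by omega),
    if_neg (show d ≠ 0 by omega)]
  ring

/-- Coefficient of `x`. [folklore] -/
theorem coeff_hQ4_one (d : ℕ) (hd : 2 ≤ d) : (hQ4 d).coeff 1 = -2 ^ (2 * d + 1) := by
  rw [coeff_hQ4, if_neg (show 1 ≠ 2 * d + 2 by omega), if_neg (show 1 ≠ 2 * d + 1 by omega),
    if_neg (show 1 ≠ d + 2 by omega), if_neg (show 1 ≠ d by omega), if_pos rfl,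
    if_neg (show (1:ℕ) ≠ 0 by omega)]
  ring

/-- Constant coefficient `H_d(0) = 4^{d+1} = q^g`. [folklore] -/
theorem coeff_hQ4_zero (d : ℕ) (hd : 2 ≤ d) : (hQ4 d).coeff 0 = 2 ^ (2 * d + 2) := by
  rw [coeff_hQ4, if_neg (show 0 ≠ 2 * d + 2 by omega), if_neg (show 0 ≠ 2 * d + 1 by omega),
    if_neg (show 0 ≠ d + 2 by omega), if_neg (show 0 ≠ d by omega), if_neg (show (0:ℕ) ≠ 1 by omega),
    if_pos rfl]
  ring

/-- Every other coefficient vanishes. [folklore] -/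
theorem coeff_hQ4_other (d j : ℕ) (h0 : j ≠ 0) (h1 : j ≠ 1) (h2 : j ≠ d) (h3 : j ≠ d + 2)
    (h4 : j ≠ 2 * d + 1) (h5 : j ≠ 2 * d + 2) : (hQ4 d).coeff j = 0 := by
  rw [coeff_hQ4, if_neg h5, if_neg h4, if_neg h3, if_neg h2, if_neg h1, if_neg h0]
  ring

/-- The coefficient functional equation `q^g c_j = q^i c_i` (`i + j = 2g`, `q = 4`, `g = d + 1`):
`H_d` is FE-honest. [folklore] -/
theorem hQ4_fe (d : ℕ) (hd : 2 ≤ d) : ∀ i j, i + j = 2 * (d + 1) →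
    ((4 : ℕ) : ℤ) ^ (d + 1) * (hQ4 d).coeff j = ((4 : ℕ) : ℤ) ^ i * (hQ4 d).coeff i := by
  intro i j hij
  rw [show ((4 : ℕ) : ℤ) = 2 ^ 2 by norm_num, ← pow_mul, ← pow_mul]
  by_cases hj0 : j = 0
  · subst hj0; obtain rfl : i = 2 * d + 2 := by omega
    rw [coeff_hQ4_zero d hd, coeff_hQ4_top d hd]; ring
  by_cases hj1 : j = 1
  · subst hj1; obtain rfl : i = 2 * d + 1 := by omega
    rw [coeff_hQ4_one d hd, coeff_hQ4_sub_one d hd]; ring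
  by_cases hj2 : j = d
  · subst hj2; obtain rfl : i = j + 2 := by omega
    rw [coeff_hQ4_mid_lo j hd, coeff_hQ4_mid_hi j hd]; ring
  by_cases hj3 : j = d + 2
  · subst hj3; obtain rfl : i = d := by omega
    rw [coeff_hQ4_mid_lo i hd, coeff_hQ4_mid_hi i hd]; ring
  by_cases hj4 : j = 2 * d + 1
  · subst hj4; obtain rfl : i = 1 := by omega
    rw [coeff_hQ4_one d hd, coeff_hQ4_sub_one d hd]; ring
  by_cases hj5 : j = 2 * d + 2
  · subst hj5; obtain rfl : i = 0 := by omega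
    rw [coeff_hQ4_zero d hd, coeff_hQ4_top d hd]; ring
  rw [coeff_hQ4_other d j hj0 hj1 hj2 hj3 hj4 hj5,
    coeff_hQ4_other d i (by omega) (by omega) (by omega) (by omega) (by omega) (by omega)]
  simp

/-- Root-level FE: the root multiset of `H_d` is closed under `α ↦ 4/α`. [folklore] -/
theorem frobRoots_hQ4_reciprocal (d : ℕ) (hd : 2 ≤ d) :
    (frobRoots (hQ4 d)).map (fun α => ((4 : ℝ) : ℂ) / α) = frobRoots (hQ4 d) := by
  have h := frobRoots_map_div_of_fe_real (q := 4) (by norm_num)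
    (by rw [natDegree_hQ4 d hd]; ring) (hQ4_fe d hd)
  simpa using h

/-- `H_d(0) ≠ 0`: `0` is not a root. [folklore] -/
theorem zero_not_mem_frobRoots_hQ4 (d : ℕ) (hd : 2 ≤ d) : (0 : ℂ) ∉ frobRoots (hQ4 d) :=
  zero_not_mem_frobRoots_of_fe (q := 4) (by norm_num) (by rw [natDegree_hQ4 d hd]; ring) (hQ4_fe d hd)

/-- The elementary symmetric functions of the roots that the window `M = 2d = 2g - 2` sees
(`1 ≤ k ≤ 2d`): `e_1 = 2`, `e_d = (-1)^{d+1}`, `e_{d+2} = -4·(-1)^d`, all others `0`. [folklore] -/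
def eQ4 (d k : ℕ) : ℂ :=
  if k = 1 then 2 else if k = d then (-1) ^ (d + 1) else if k = d + 2 then -4 * (-1) ^ d else 0

/-- `e_k(roots H_d) = eQ4 d k` for `1 ≤ k ≤ 2d` (`3 ≤ d`). [folklore] -/
theorem esymm_hQ4 (d : ℕ) (hd : 3 ≤ d) (k : ℕ) (hk1 : 1 ≤ k) (hk : k ≤ 2 * d) :
    (frobRoots (hQ4 d)).esymm k = eQ4 d k := by
  have hd2 : 2 ≤ d := by omega
  rw [esymm_frobRoots (hQ4_monic d hd2) (by rw [natDegree_hQ4 d hd2]; omega), natDegree_hQ4 d hd2, eQ4]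
  by_cases h1 : k = 1
  · subst h1
    rw [if_pos rfl, show 2 * d + 2 - 1 = 2 * d + 1 by omega, coeff_hQ4_sub_one d hd2]; push_cast; ring
  rw [if_neg h1]
  by_cases h2 : k = d
  · subst h2
    rw [if_pos rfl, show 2 * k + 2 - k = k + 2 by omega, coeff_hQ4_mid_hi k hd2]; push_cast; ring
  rw [if_neg h2]
  by_cases h3 : k = d + 2
  · subst h3
    rw [if_pos rfl, show 2 * d + 2 - (d + 2) = d by omega, coeff_hQ4_mid_lo d hd2]; push_cast; ring
  rw [if_neg h3, coeff_hQ4_other d (2 * d + 2 - k) (by omega) (by omega) (by omega) (by omega) (by omega)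
    (by omega)]
  simp

/-! ## The power sums in the window: closed form -/

/-- Closed form of `s_n(H_d)` for `1 ≤ n ≤ 2d`:
`2^n` (`n < d`), `2^d + d`, `2^{d+1} + 2(d+1)`, `2^n + n·2^{n-d+1}` (`d + 2 ≤ n < 2d`),
`2^{2d} + 4d·2^d + d` (`n = 2d`). [folklore] -/
def sQ4 (d n : ℕ) : ℕ :=
  2 ^ n + (if d ≤ n then n * 2 ^ (n - d) * (if d + 2 ≤ n then 2 else 1) else 0) +
    (if n = 2 * d then d else 0)

/-- The closed form satisfies the sparse Newton recursion of `H_d`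
(`n e_n = (-1)^{n+1}(s_n - 2 s_{n-1} - s_{n-d} - 4 s_{n-d-2})`, brackets as present). [folklore] -/
theorem sQ4_newton (d : ℕ) (hd : 3 ≤ d) (n : ℕ) (hn1 : 1 ≤ n) (hn : n ≤ 2 * d) :
    (n : ℂ) * eQ4 d n = (-1) ^ (n + 1) *
      ((sQ4 d n : ℂ) - (if 1 < n then 2 * (sQ4 d (n - 1) : ℂ) else 0)
        - (if d < n then (sQ4 d (n - d) : ℂ) else 0)
        - (if d + 2 < n then 4 * (sQ4 d (n - d - 2) : ℂ) else 0)) := by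
  unfold eQ4 sQ4
  rcases Nat.lt_or_ge n d with hlt | hge
  · -- n < d
    rcases Nat.lt_or_ge n 2 with h2 | h2
    · obtain rfl : n = 1 := by omega
      have c1 : ¬ d ≤ 1 := by omega
      have c2 : (1:ℕ) ≠ 2 * d := by omega
      have c3 : ¬ d < 1 := by omega
      have c5 : ¬ d + 2 < 1 := by omega
      simp [c1, c2, c3, c5]
    · obtain ⟨m, rfl⟩ : ∃ m, n = m + 2 := ⟨n - 2, by omega⟩
      have c1 : ¬ d ≤ m + 2 := by omega
      have c2 : m + 2 ≠ 2 * d := by omega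
      have c3 : m + 2 ≠ 1 := by omega
      have c4 : m + 2 ≠ d := by omega
      have c6 : ¬ d ≤ m + 1 := by omega
      have c7 : m + 1 ≠ 2 * d := by omega
      have c8 : ¬ d < m + 2 := by omega
      have c9 : ¬ d + 2 < m + 2 := by omega
      have c10 : m + 2 - 1 = m + 1 := by omega
      have c11 : m ≠ d := by omega
      simp [c1, c2, c3, c4, c6, c7, c8, c9, c10, c11]
      ring
  · obtain ⟨e, rfl⟩ : ∃ e, d = e + 3 := ⟨d - 3, by omega⟩
    rcases Nat.lt_or_ge n (e + 6) with hlo | hhi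
    · -- n ∈ {d, d+1, d+2}
      have : n = e + 3 ∨ n = e + 4 ∨ n = e + 5 := by omega
      rcases this with rfl | rfl | rfl
      · have c1 : e + 3 - 1 = e + 2 := by omega
        have c2 : ¬ e + 3 ≤ e + 2 := by omega
        have c3 : e + 2 ≠ 2 * (e + 3) := by omega
        have c4 : e + 3 ≠ 2 * (e + 3) := by omega
        have c5 : ¬ e + 3 + 2 ≤ e + 3 := by omega
        simp [c1, c2, c3, c4, c5]
        ring
      · have c1 : e + 4 - 1 = e + 3 := by omega
        have c2 : e + 4 ≠ 1 := by omega
        have c5 : e + 3 ≤ e + 4 := by omega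
        have c6 : ¬ e + 3 + 2 ≤ e + 4 := by omega
        have c7 : e + 4 ≠ 2 * (e + 3) := by omega
        have c8 : e + 3 ≠ 2 * (e + 3) := by omega
        have c9 : ¬ e + 3 + 2 ≤ e + 3 := by omega
        have c10 : e + 4 - (e + 3) = 1 := by omega
        have c11 : ¬ e + 3 ≤ 1 := by omega
        have c12 : (1:ℕ) ≠ 2 * (e + 3) := by omega
        have c13 : e + 3 < e + 4 := by omega
        have c14 : ¬ e + 3 + 2 < e + 4 := by omega
        simp [c1, c2, c5, c6, c7, c8, c9, c10, c11, c12, c13, c14]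
        ring
      · have c1 : e + 5 - 1 = e + 4 := by omega
        have c2 : e + 5 ≠ 1 := by omega
        have c4 : e + 5 = e + 3 + 2 := by omega
        have c5 : e + 3 ≤ e + 5 := by omega
        have c7 : e + 5 ≠ 2 * (e + 3) := by omega
        have c8 : e + 3 ≤ e + 4 := by omega
        have c9 : ¬ e + 3 + 2 ≤ e + 4 := by omega
        have c10 : e + 4 ≠ 2 * (e + 3) := by omega
        have c11 : e + 5 - (e + 3) = 2 := by omega
        have c12 : ¬ e + 3 ≤ 2 := by omega
        have c13 : (2:ℕ) ≠ 2 * (e + 3) := by omega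
        have c14 : e + 3 < e + 5 := by omega
        have c16 : e + 4 - (e + 3) = 1 := by omega
        simp [c1, c2, c4, c5, c7, c8, c9, c10, c11, c12, c13, c14, c16]
        ring
    · rcases Nat.lt_or_ge n (2 * (e + 3)) with hlo2 | htop
      · -- d + 3 ≤ n ≤ 2d - 1
        obtain ⟨m, rfl⟩ : ∃ m, n = e + 6 + m := ⟨n - (e + 6), by omega⟩
        have c1 : e + 6 + m ≠ 1 := by omega
        have c2 : e + 6 + m ≠ e + 3 := by omega
        have c3 : e + 6 + m ≠ e + 3 + 2 := by omega
        have c4 : e + 3 ≤ e + 6 + m := by omega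
        have c5 : e + 3 + 2 ≤ e + 6 + m := by omega
        have c6 : e + 6 + m ≠ 2 * (e + 3) := by omega
        have c7 : e + 6 + m - 1 = e + 5 + m := by omega
        have c8 : e + 3 ≤ e + 5 + m := by omega
        have c9 : e + 3 + 2 ≤ e + 5 + m := by omega
        have c10 : e + 5 + m ≠ 2 * (e + 3) := by omega
        have c11 : e + 6 + m - (e + 3) = m + 3 := by omega
        have c12 : ¬ e + 3 ≤ m + 3 := by omega
        have c13 : m + 3 ≠ 2 * (e + 3) := by omega
        have c15 : ¬ e + 3 ≤ m + 1 := by omega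
        have c16 : m + 1 ≠ 2 * (e + 3) := by omega
        have c17 : e + 3 < e + 6 + m := by omega
        have c18 : e + 3 + 2 < e + 6 + m := by omega
        have c19 : 1 < e + 6 + m := by omega
        have c21 : e + 5 + m - (e + 3) = m + 2 := by omega
        simp [c1, c2, c3, c4, c5, c6, c7, c8, c9, c10, c11, c12, c13, c15, c16, c17, c18, c19,
          c21]
        ring
      · -- n = 2d
        obtain rfl : n = 2 * (e + 3) := by omega
        have c1 : 2 * (e + 3) ≠ 1 := by omega
        have c2 : 2 * (e + 3) ≠ e + 3 := by omega
        have c3 : 2 * (e + 3) ≠ e + 3 + 2 := by omega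
        have c4 : e + 3 ≤ 2 * (e + 3) := by omega
        have c5 : e + 3 + 2 ≤ 2 * (e + 3) := by omega
        have c7 : 2 * (e + 3) - 1 = e + 5 + e := by omega
        have c8 : e + 3 ≤ e + 5 + e := by omega
        have c9 : e + 3 + 2 ≤ e + 5 + e := by omega
        have c10 : e + 5 + e ≠ 2 * (e + 3) := by omega
        have c11 : 2 * (e + 3) - (e + 3) = e + 3 := by omega
        have c13 : e + 3 ≠ 2 * (e + 3) := by omega
        have c15 : ¬ e + 3 ≤ e + 1 := by omega
        have c16 : e + 1 ≠ 2 * (e + 3) := by omega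
        have c17 : e + 3 < 2 * (e + 3) := by omega
        have c18 : e + 3 + 2 < 2 * (e + 3) := by omega
        have c19 : 1 < 2 * (e + 3) := by omega
        have c20 : e + 5 + e - (e + 3) = e + 2 := by omega
        have c21 : ¬ e + 3 + 2 ≤ e + 3 := by omega
        simp [c1, c2, c3, c4, c5, c7, c8, c9, c10, c11, c13, c15, c16, c17, c18, c19, c20,
          c21]
        ring

/-- THE WINDOW POWER SUMS of `H_d` (`3 ≤ d`, `1 ≤ n ≤ 2d`): `s_n(roots H_d) = sQ4 d n` — obtained from the
coefficients alone by Newton's identities (no root of `H_d` is ever computed). [folklore] -/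
theorem powerSum_hQ4 (d : ℕ) (hd : 3 ≤ d) :
    ∀ n, 1 ≤ n → n ≤ 2 * d → powerSum (frobRoots (hQ4 d)) n = (sQ4 d n : ℂ) := by
  intro n
  induction n using Nat.strong_induction_on with
  | _ n ih =>
    intro hn1 hn
    set A := frobRoots (hQ4 d) with hA
    have hN := newton_range A n
    rw [sum_range_of_support_four (d := d) (by omega) n (fun i hi h0 h1 h2 h3 => by
      rw [esymm_hQ4 d hd i (by omega) (by omega), eQ4, if_neg h1, if_neg h2, if_neg h3]; ring)] at hN
    rw [if_pos (by omega : 0 < n), multiset_esymm_zero, esymm_hQ4 d hd n hn1 hn, Nat.sub_zero] at hN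
    have hS := sQ4_newton d hd n hn1 hn
    -- rewrite the known terms of Newton's identity
    have h1 : (if 1 < n then (-1 : ℂ) ^ 1 * A.esymm 1 * powerSum A (n - 1) else 0) =
        -(if 1 < n then 2 * (sQ4 d (n - 1) : ℂ) else 0) := by
      split_ifs with h
      · rw [esymm_hQ4 d hd 1 le_rfl (by omega), eQ4, if_pos rfl, ih (n - 1) (by omega) (by omega) (by omega)]
        ring
      · simp
    have hm0 : (-1 : ℂ) ^ (2 * d) = 1 := by rw [pow_mul]; norm_num
    have hm1 : (-1 : ℂ) ^ d * (-1) ^ (d + 1) = -1 := by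
      rw [← pow_add, show d + (d + 1) = 2 * d + 1 by ring, pow_succ, hm0]; norm_num
    have hm2 : (-1 : ℂ) ^ (d + 2) * (-4 * (-1) ^ d) = -4 := by
      rw [show (-1 : ℂ) ^ (d + 2) * (-4 * (-1) ^ d) = -4 * ((-1) ^ (d + 2) * (-1) ^ d) by ring,
        ← pow_add, show d + 2 + d = 2 * (d + 1) by ring, pow_mul]
      norm_num
    have h2 : (if d < n then (-1 : ℂ) ^ d * A.esymm d * powerSum A (n - d) else 0) =
        -(if d < n then (sQ4 d (n - d) : ℂ) else 0) := by
      split_ifs with h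
      · rw [esymm_hQ4 d hd d (by omega) (by omega), eQ4, if_neg (by omega), if_pos rfl,
          ih (n - d) (by omega) (by omega) (by omega), hm1]
        ring
      · simp
    have h3 : (if d + 2 < n then (-1 : ℂ) ^ (d + 2) * A.esymm (d + 2) * powerSum A (n - (d + 2)) else 0) =
        -(if d + 2 < n then 4 * (sQ4 d (n - d - 2) : ℂ) else 0) := by
      split_ifs with h
      · rw [esymm_hQ4 d hd (d + 2) (by omega) (by omega), eQ4, if_neg (by omega), if_neg (by omega),
          if_pos rfl, show n - (d + 2) = n - d - 2 by omega,
          ih (n - d - 2) (by omega) (by omega) (by omega), hm2]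
        ring
      · simp
    rw [h1, h2, h3, pow_zero, one_mul, one_mul] at hN
    have hu : ((-1 : ℂ) ^ (n + 1)) ≠ 0 := pow_ne_zero _ (by norm_num)
    have h := mul_left_cancel₀ hu (hN.symm.trans hS)
    linear_combination h

end Summit.RiemannHypothesis.RiemannHypothesis.Theorems.PfPersistence.FfAngleTwin

end
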